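import Summits.ABC.IUTFork.DAGC312p
import Summits.ABC.IUTFork.Cor312TeamAHonestCensus
import Summits.ABC.IUTFork.Cor312IdentifiedChain
import HarnessLib

/-!
# [IUTchIII] Cor. 3.12, proof steps — the kernel DAG step nodes SOLVED FOR CONTENT and RE-CLOSED, part A:
# generic lemmas for `Step.Holds (locusNode pending) O`, and the nodes opening ¶, (i), (ii), (iv)
# (FACT-LIST rows F-2153 opening ¶, F-2154 (i), F-2155 (ii), F-2157 (iv); parts B/C do (v)–(xii); zero FACT binders)

S. Mochizuki, *Inter-universal Teichmüller theory III*, proof of Cor. 3.12, kurims `.tex` p. 174 l. 20 – p. 180 l. 42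
[Mochizuki2012; claim key, status disputed]. PROOF-ONLY companion (no definition, no instance, no named fact; abc-iut
cell, seat abc-iut-L1-d1 gen 11; sibling of `Cor312StepIIINodeReclose` = row F-2156, step (iii)) of the index nodes
`Summit.ABC.IUTFork.DAG.N_IUTchIII_Cor3_12_pf_<s> pending O := Cor312Proof.Step.<s>.Holds (locusNode pending) O`
(`DAGC312b.lean`; per-node data `Step.data` in `Cor312Steps.lean`, READ ON THE PAGE: cited loci, invoked earlier
observations `uses`, drawn observations `concl`). Every such node is PARAMETRISED by two readings — `pending : Locus →
Prop` (which cited loci one grants) and `O : Obs → Prop` (which of the proof's own observations one grants) — and is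
the inference "cited loci ∧ invoked observations ⟹ drawn observations". The FACT-LIST census asks what the closers
of each node bind; this file answers uniformly, in the kernel, BY NAME.

* §0 GENERIC (any node `s`): `stepNode_iff` (the node is its inference, definitionally); zero-binder partial
  closures `stepNode_holds_of_concl` / `_of_all` / `_of_not_cites`; `step_concl_ne_nil_disjoint` — EVERY node draws
  at least one observation and never one it invokes (`decide` over the landed data) —, whence
  `stepNode_not_automatic_of_mem` / `stepNode_not_automatic` (granting every locus and every observation except the
  node's own conclusions violates the node), `stepNode_not_forall` (THE UNIVERSAL CLOSURE OVER BOTH READINGS IS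
  REFUTED FOR EVERY NODE — the schema is never a theorem; its instance forms are the content), and the two
  closures DECIDED: `stepNode_forall_obs_iff` (over observation readings: iff the loci reading fails to grant all
  cited loci), `stepNode_forall_loci_iff` (over loci readings: iff the content implication `uses ⟹ concl` holds);
  instance helpers at the typed readings: `stepNode_holds_identifiedObs` (Scholze–Stix identified-copies reading
  [ScholzeStix2018] §2.2, `Cor312.Setting.identifiedObs`: zero binders when the node draws no contentful
  observation, `Cor312.identifiedContentful`; `_of_identifiedReading` otherwise, from R-1's collapse
  `identifiedObs_holds`), `honestReading_preX` / `OPreX_preX` (TEAM A's `Cor312Proof.honestReading` and the overlay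
  `Cor312Vol.PreX.OPreX` grant the sixteen pre-(x) observations `Obs.all.take 16` outright — fifteen `True` arms
  and the gluing-data existence `PreX.linkGluing_nonempty`), `stepNode_holds_honestReading_preX` /
  `stepNode_holds_OPreX_preX`.
* §1–§4 PER NODE, name-matched one-liners on `N_IUTchIII_Cor3_12_pf_<s>` for the opening ¶, (i), (ii), (iv):
  `_iff` (SOLVED FOR CONTENT, the invoked/drawn observations spelled out), `_not_automatic` + `not_forall_…`
  (∀-closure refuted, explicit reading), `forall_obs_…_iff`, `forall_loci_…_iff`, and the zero-binder instances
  `_holds_identifiedObs` (or `_of_identifiedReading` for (i), (ii), which draw contentful observations),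
  `_holds_honestReading`, `_holds_OPreX`. The reading of record `DAG.obsReadingA` is part p's `…_holds` (not
  restated). Sibling parts B ((v)–(ix)) and C ((x)–(xii), (xi-f) excluded: closed, part t) import this one.

HONEST FRAMING. A step node is an INFERENCE of a disputed text under explicit readings; "re-closed" = OUR kernel
theorems about that inference with no assumption-class binder; the nodes here are the proof's set-up and method
prose before the quantitative spine. Nothing here bears on the disputed node (xi-f), takes a side on [IUTchIII]
Cor. 3.12 or on any author (Mochizuki / Scholze–Stix), or asserts that abc is proved or refuted; typed ≠ proved;
indexed ≠ endorsed. [claim: Mochizuki2012, status: disputed]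
-/

namespace Summit.ABC.IUTFork.DAG

open Cor312Proof Thm311 Literature.IUT.LogThetaLattice

/-! ## §0 Generic: a step node under the readings `(pending, O)` -/

section Generic

variable (pending : Locus → Prop) (O : Obs → Prop)

/-- A step node under `(pending, O)` IS its inference "cited loci ∧ invoked observations ⟹ drawn observations"
(definitional; `locusNode pending = pending`, part b). [claim: Mochizuki2012, status: disputed] -/
theorem stepNode_iff (s : Step) :
    s.Holds (locusNode pending) O ↔
      ((∀ c ∈ s.cites, pending c) → (∀ o ∈ s.uses, O o) → ∀ o ∈ s.concl, O o) :=
  Iff.rfl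

/-- Zero-binder partial closure: the node holds at every observation reading granting its conclusions. [folklore] -/
theorem stepNode_holds_of_concl (s : Step) (h : ∀ o ∈ s.concl, O o) : s.Holds (locusNode pending) O :=
  fun _ _ => h

/-- … in particular at every observation reading granting everything. [folklore] -/
theorem stepNode_holds_of_all (s : Step) (h : ∀ o, O o) : s.Holds (locusNode pending) O :=
  fun _ _ o _ => h o

/-- Zero-binder partial closure: the node holds (vacuously) at every loci reading not granting all its cited loci.
[folklore] -/
theorem stepNode_holds_of_not_cites (s : Step) (h : ¬ ∀ c ∈ s.cites, pending c) :
    s.Holds (locusNode pending) O :=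
  fun hc => absurd hc h

/-- DATA CHECK (`decide` over `Step.data`): every one of the twenty nodes draws at least one observation, and never
an observation it invokes. [folklore] -/
theorem step_concl_ne_nil_disjoint : ∀ s : Step, s.concl ≠ [] ∧ ∀ o ∈ s.concl, o ∉ s.uses := by
  intro s
  cases s <;> decide

/-- **NOT AUTOMATIC, pointwise**: granting every locus and every observation except ONE conclusion `o` of the node
(not among its invoked observations) violates the node. [folklore] -/
theorem stepNode_not_automatic_of_mem (s : Step) (o : Obs) (ho : o ∈ s.concl) (hu : o ∉ s.uses) :
    ¬ s.Holds (locusNode fun _ => True) (fun o' => o' ≠ o) :=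
  fun hs => hs (fun _ _ => trivial) (fun _ ho' h => hu (h ▸ ho')) o ho rfl

/-- **NOT AUTOMATIC**: granting every locus and every observation except the node's own conclusions violates the
node (every node, by `step_concl_ne_nil_disjoint`). [folklore] -/
theorem stepNode_not_automatic (s : Step) :
    ¬ s.Holds (locusNode fun _ => True) (fun o => o ∉ s.concl) := by
  intro hs
  obtain ⟨hne, hdisj⟩ := step_concl_ne_nil_disjoint s
  obtain ⟨o, ho⟩ := List.exists_mem_of_ne_nil s.concl hne
  exact hs (fun _ _ => trivial) (fun o' ho' hc' => hdisj o' hc' ho') o ho ho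

/-- **THE UNIVERSAL CLOSURE OVER BOTH READINGS IS REFUTED, FOR EVERY NODE**: the schema
`∀ pending O, Step.<s>.Holds (locusNode pending) O` is never a theorem. [folklore] -/
theorem stepNode_not_forall (s : Step) :
    ¬ ∀ (pending' : Locus → Prop) (O' : Obs → Prop), s.Holds (locusNode pending') O' :=
  fun h => stepNode_not_automatic s (h _ _)

/-- CLOSURE OVER OBSERVATION READINGS, DECIDED: for a fixed loci reading the node holds under EVERY observation
reading iff the loci reading does not grant all the node's cited loci. [folklore] -/
theorem stepNode_forall_obs_iff (s : Step) :
    (∀ O' : Obs → Prop, s.Holds (locusNode pending) O') ↔ ¬ ∀ c ∈ s.cites, pending c := by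
  refine ⟨fun hall hc => ?_, fun hn O' => stepNode_holds_of_not_cites pending O' s hn⟩
  obtain ⟨hne, hdisj⟩ := step_concl_ne_nil_disjoint s
  obtain ⟨o, ho⟩ := List.exists_mem_of_ne_nil s.concl hne
  exact hall (fun o' => o' ∉ s.concl) hc (fun o' ho' hc' => hdisj o' hc' ho') o ho ho

/-- CLOSURE OVER LOCI READINGS, DECIDED: for a fixed observation reading the node holds under EVERY loci reading iff
its content implication "invoked observations ⟹ drawn observations" holds. [folklore] -/
theorem stepNode_forall_loci_iff (s : Step) :
    (∀ pending' : Locus → Prop, s.Holds (locusNode pending') O) ↔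
      ((∀ o ∈ s.uses, O o) → ∀ o ∈ s.concl, O o) :=
  ⟨fun h => h (fun _ => True) (fun _ _ => trivial), fun h _ _ => h⟩

end Generic

section TypedReadings

variable {T : ThetaIndex} {S : Situation T} (pending : Locus → Prop) (P : Cor312.Setting S)

/-- At the Scholze–Stix identified-copies reading a node drawing NO contentful observation (table
`Cor312.identifiedContentful`) holds under every loci reading, zero binders. [folklore] -/
theorem stepNode_holds_identifiedObs (s : Step) (h : ∀ o ∈ s.concl, Cor312.identifiedContentful o = false) :
    s.Holds (locusNode pending) P.identifiedObs :=
  stepNode_holds_of_concl pending _ s fun o ho => Cor312.Setting.identifiedObs_of_not_contentful P o (h o ho)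

/-- At the identified-copies reading EVERY node holds once the setting carries the identified reading (R-1's
collapse `identifiedObs_holds`: all 36 observations, so read, hold) — one binder on DATA, not a FACT row. [folklore] -/
theorem stepNode_holds_identifiedObs_of_identifiedReading (s : Step) (hP : P.IdentifiedReading) :
    s.Holds (locusNode pending) P.identifiedObs :=
  stepNode_holds_of_all pending _ s (Cor312.Setting.IdentifiedReading.identifiedObs_holds hP)

/-- TEAM A's honest reading GRANTS the sixteen pre-(x) observations (`Obs.all.take 16`: opening ¶ – step (ix))
outright: fifteen `True` arms and the gluing-data existence `PreX.linkGluing_nonempty`. [folklore] -/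
theorem honestReading_preX (C : Column S.L) (D : ThetaLinkStrips P.LogLink P.Strip) (L : Locus → Prop)
    (A : InputStrip.StripAlgorithm P) : ∀ o ∈ Obs.all.take 16, honestReading P C D L A o := by
  intro o ho
  simp only [Obs.all, List.take, List.mem_cons, List.not_mem_nil, or_false] at ho
  rcases ho with rfl | rfl | rfl | rfl | rfl | rfl | rfl | rfl | rfl | rfl | rfl | rfl | rfl | rfl | rfl | rfl <;>
    first | exact trivial | exact Cor312Vol.PreX.linkGluing_nonempty P

/-- The pre-(x) overlay `Cor312Vol.PreX.OPreX` GRANTS the same sixteen observations outright, over any base. [folklore] -/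
theorem OPreX_preX (base : Obs → Prop) : ∀ o ∈ Obs.all.take 16, Cor312Vol.PreX.OPreX P base o := by
  intro o ho
  simp only [Obs.all, List.take, List.mem_cons, List.not_mem_nil, or_false] at ho
  rcases ho with rfl | rfl | rfl | rfl | rfl | rfl | rfl | rfl | rfl | rfl | rfl | rfl | rfl | rfl | rfl | rfl <;>
    first | exact trivial | exact Cor312Vol.PreX.linkGluing_nonempty P

/-- Hence a node drawing only pre-(x) observations holds at the honest reading under every loci reading, for every
column, strips datum, loci parameter and strip algorithm, zero binders. [folklore] -/
theorem stepNode_holds_honestReading_preX (s : Step) (h : ∀ o ∈ s.concl, o ∈ Obs.all.take 16) (C : Column S.L)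
    (D : ThetaLinkStrips P.LogLink P.Strip) (L : Locus → Prop) (A : InputStrip.StripAlgorithm P) :
    s.Holds (locusNode pending) (honestReading P C D L A) :=
  stepNode_holds_of_concl pending _ s fun o ho => honestReading_preX P C D L A o (h o ho)

/-- … and at the pre-(x) overlay over every base reading, zero binders. [folklore] -/
theorem stepNode_holds_OPreX_preX (s : Step) (h : ∀ o ∈ s.concl, o ∈ Obs.all.take 16) (base : Obs → Prop) :
    s.Holds (locusNode pending) (Cor312Vol.PreX.OPreX P base) :=
  stepNode_holds_of_concl pending _ s fun o ho => OPreX_preX P base o (h o ho)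

end TypedReadings

/-! ## §1–§9 The nine pre-(x) nodes other than (iii), by name -/

section Nodes

variable (pending : Locus → Prop) (O : Obs → Prop) {T : ThetaIndex} {S : Situation T} (P : Cor312.Setting S)
  (C : Column S.L) (D : ThetaLinkStrips P.LogLink P.Strip) (L : Locus → Prop) (A : InputStrip.StripAlgorithm P)
  (base : Obs → Prop)

/-! ### Opening ¶ `N_IUTchIII_Cor3_12_pf_WLOG` — row F-2153 · p. 174 l. 20 – p. 175 l. 13 -/

/-- Opening ¶ SOLVED FOR CONTENT: its twelve cited loci granted ⟹ `restrictToStrips` granted (invokes nothing).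
[claim: Mochizuki2012, status: disputed] -/
theorem N_IUTchIII_Cor3_12_pf_WLOG_iff :
    N_IUTchIII_Cor3_12_pf_WLOG pending O ↔ ((∀ c ∈ Step.wlog.cites, pending c) → O .restrictToStrips) :=
  (stepNode_iff pending O .wlog).trans (by simp [Step.uses, Step.concl, Step.data])
/-- NOT AUTOMATIC: all loci and all observations but `restrictToStrips` granted violates the node. [folklore] -/
theorem N_IUTchIII_Cor3_12_pf_WLOG_not_automatic :
    ¬ N_IUTchIII_Cor3_12_pf_WLOG (fun _ => True) (fun o => o ≠ .restrictToStrips) :=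
  stepNode_not_automatic_of_mem .wlog _ (by decide) (by decide)
/-- ∀-CLOSURE REFUTED (schema; instance forms are the content). [folklore] -/
theorem not_forall_N_IUTchIII_Cor3_12_pf_WLOG :
    ¬ ∀ (pending' : Locus → Prop) (O' : Obs → Prop), N_IUTchIII_Cor3_12_pf_WLOG pending' O' :=
  stepNode_not_forall .wlog
/-- Closure over observation readings: iff not all twelve cited loci are granted. [folklore] -/
theorem forall_obs_N_IUTchIII_Cor3_12_pf_WLOG_iff :
    (∀ O' : Obs → Prop, N_IUTchIII_Cor3_12_pf_WLOG pending O') ↔ ¬ ∀ c ∈ Step.wlog.cites, pending c :=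
  stepNode_forall_obs_iff pending .wlog
/-- Closure over loci readings: iff `restrictToStrips` is granted. [folklore] -/
theorem forall_loci_N_IUTchIII_Cor3_12_pf_WLOG_iff :
    (∀ pending' : Locus → Prop, N_IUTchIII_Cor3_12_pf_WLOG pending' O) ↔ O .restrictToStrips :=
  (stepNode_forall_loci_iff O .wlog).trans (by simp [Step.uses, Step.concl, Step.data])
/-- Zero binders at the identified-copies reading. [folklore] -/
theorem N_IUTchIII_Cor3_12_pf_WLOG_holds_identifiedObs : N_IUTchIII_Cor3_12_pf_WLOG pending P.identifiedObs :=
  stepNode_holds_identifiedObs pending P .wlog (by decide)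
/-- Zero binders at TEAM A's honest reading. [folklore] -/
theorem N_IUTchIII_Cor3_12_pf_WLOG_holds_honestReading :
    N_IUTchIII_Cor3_12_pf_WLOG pending (honestReading P C D L A) :=
  stepNode_holds_honestReading_preX pending P .wlog (by decide) C D L A
/-- Zero binders at the pre-(x) overlay. [folklore] -/
theorem N_IUTchIII_Cor3_12_pf_WLOG_holds_OPreX :
    N_IUTchIII_Cor3_12_pf_WLOG pending (Cor312Vol.PreX.OPreX P base) :=
  stepNode_holds_OPreX_preX pending P .wlog (by decide) base

/-! ### (i) `N_IUTchIII_Cor3_12_pf_i` — row F-2154 · p. 175 l. 19–49 -/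

/-- (i) SOLVED FOR CONTENT: Def 3.8 (ii), Def 2.4 (iii), Rmk 3.8.1 granted ⟹ `linkSplits` and `valueGroupMapsPilots`
granted (invokes nothing). [claim: Mochizuki2012, status: disputed] -/
theorem N_IUTchIII_Cor3_12_pf_i_iff :
    N_IUTchIII_Cor3_12_pf_i pending O ↔
      ((∀ c ∈ Step.i.cites, pending c) → O .linkSplits ∧ O .valueGroupMapsPilots) :=
  (stepNode_iff pending O .i).trans (by simp [Step.uses, Step.concl, Step.data])
/-- NOT AUTOMATIC: all loci and all observations but `linkSplits` granted violates the node. [folklore] -/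
theorem N_IUTchIII_Cor3_12_pf_i_not_automatic :
    ¬ N_IUTchIII_Cor3_12_pf_i (fun _ => True) (fun o => o ≠ .linkSplits) :=
  stepNode_not_automatic_of_mem .i _ (by decide) (by decide)
/-- ∀-CLOSURE REFUTED (schema; instance forms are the content). [folklore] -/
theorem not_forall_N_IUTchIII_Cor3_12_pf_i :
    ¬ ∀ (pending' : Locus → Prop) (O' : Obs → Prop), N_IUTchIII_Cor3_12_pf_i pending' O' :=
  stepNode_not_forall .i
/-- Closure over observation readings: iff not all three cited loci are granted. [folklore] -/
theorem forall_obs_N_IUTchIII_Cor3_12_pf_i_iff :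
    (∀ O' : Obs → Prop, N_IUTchIII_Cor3_12_pf_i pending O') ↔ ¬ ∀ c ∈ Step.i.cites, pending c :=
  stepNode_forall_obs_iff pending .i
/-- Closure over loci readings: iff both drawn observations are granted. [folklore] -/
theorem forall_loci_N_IUTchIII_Cor3_12_pf_i_iff :
    (∀ pending' : Locus → Prop, N_IUTchIII_Cor3_12_pf_i pending' O) ↔ O .linkSplits ∧ O .valueGroupMapsPilots :=
  (stepNode_forall_loci_iff O .i).trans (by simp [Step.uses, Step.concl, Step.data])
/-- (i) draws the contentful `valueGroupMapsPilots`: at the identified-copies reading it holds given the identified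
reading of the setting (data binder). [folklore] -/
theorem N_IUTchIII_Cor3_12_pf_i_holds_identifiedObs_of_identifiedReading (hP : P.IdentifiedReading) :
    N_IUTchIII_Cor3_12_pf_i pending P.identifiedObs :=
  stepNode_holds_identifiedObs_of_identifiedReading pending P .i hP
/-- Zero binders at TEAM A's honest reading (the gluing-data existence is a theorem). [folklore] -/
theorem N_IUTchIII_Cor3_12_pf_i_holds_honestReading :
    N_IUTchIII_Cor3_12_pf_i pending (honestReading P C D L A) :=
  stepNode_holds_honestReading_preX pending P .i (by decide) C D L A
/-- Zero binders at the pre-(x) overlay. [folklore] -/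
theorem N_IUTchIII_Cor3_12_pf_i_holds_OPreX : N_IUTchIII_Cor3_12_pf_i pending (Cor312Vol.PreX.OPreX P base) :=
  stepNode_holds_OPreX_preX pending P .i (by decide) base

/-! ### (ii) `N_IUTchIII_Cor3_12_pf_ii` — row F-2155 · p. 175 l. 50 – p. 176 l. 17 -/

/-- (ii) SOLVED FOR CONTENT: its fifteen cited loci granted ⟹ `unitsSubjectInd12` and `cyclotomesInsulated` granted
(invokes nothing). [claim: Mochizuki2012, status: disputed] -/
theorem N_IUTchIII_Cor3_12_pf_ii_iff :
    N_IUTchIII_Cor3_12_pf_ii pending O ↔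
      ((∀ c ∈ Step.ii.cites, pending c) → O .unitsSubjectInd12 ∧ O .cyclotomesInsulated) :=
  (stepNode_iff pending O .ii).trans (by simp [Step.uses, Step.concl, Step.data])
/-- NOT AUTOMATIC: all loci and all observations but `unitsSubjectInd12` granted violates the node. [folklore] -/
theorem N_IUTchIII_Cor3_12_pf_ii_not_automatic :
    ¬ N_IUTchIII_Cor3_12_pf_ii (fun _ => True) (fun o => o ≠ .unitsSubjectInd12) :=
  stepNode_not_automatic_of_mem .ii _ (by decide) (by decide)
/-- ∀-CLOSURE REFUTED (schema; instance forms are the content). [folklore] -/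
theorem not_forall_N_IUTchIII_Cor3_12_pf_ii :
    ¬ ∀ (pending' : Locus → Prop) (O' : Obs → Prop), N_IUTchIII_Cor3_12_pf_ii pending' O' :=
  stepNode_not_forall .ii
/-- Closure over observation readings: iff not all fifteen cited loci are granted. [folklore] -/
theorem forall_obs_N_IUTchIII_Cor3_12_pf_ii_iff :
    (∀ O' : Obs → Prop, N_IUTchIII_Cor3_12_pf_ii pending O') ↔ ¬ ∀ c ∈ Step.ii.cites, pending c :=
  stepNode_forall_obs_iff pending .ii
/-- Closure over loci readings: iff both drawn observations are granted. [folklore] -/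
theorem forall_loci_N_IUTchIII_Cor3_12_pf_ii_iff :
    (∀ pending' : Locus → Prop, N_IUTchIII_Cor3_12_pf_ii pending' O) ↔
      O .unitsSubjectInd12 ∧ O .cyclotomesInsulated :=
  (stepNode_forall_loci_iff O .ii).trans (by simp [Step.uses, Step.concl, Step.data])
/-- (ii) draws the contentful `unitsSubjectInd12`: at the identified-copies reading it holds given the identified
reading of the setting (data binder). [folklore] -/
theorem N_IUTchIII_Cor3_12_pf_ii_holds_identifiedObs_of_identifiedReading (hP : P.IdentifiedReading) :
    N_IUTchIII_Cor3_12_pf_ii pending P.identifiedObs :=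
  stepNode_holds_identifiedObs_of_identifiedReading pending P .ii hP
/-- Zero binders at TEAM A's honest reading. [folklore] -/
theorem N_IUTchIII_Cor3_12_pf_ii_holds_honestReading :
    N_IUTchIII_Cor3_12_pf_ii pending (honestReading P C D L A) :=
  stepNode_holds_honestReading_preX pending P .ii (by decide) C D L A
/-- Zero binders at the pre-(x) overlay. [folklore] -/
theorem N_IUTchIII_Cor3_12_pf_ii_holds_OPreX : N_IUTchIII_Cor3_12_pf_ii pending (Cor312Vol.PreX.OPreX P base) :=
  stepNode_holds_OPreX_preX pending P .ii (by decide) base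

/-! ### (iv) `N_IUTchIII_Cor3_12_pf_iv` — row F-2157 · p. 176 l. 34 – p. 177 l. 8 -/

/-- (iv) SOLVED FOR CONTENT: its eight cited loci granted ⟹ (observation (iii) `singleLinkNecessary` ⟹
`verticalShiftSolved`). [claim: Mochizuki2012, status: disputed] -/
theorem N_IUTchIII_Cor3_12_pf_iv_iff :
    N_IUTchIII_Cor3_12_pf_iv pending O ↔
      ((∀ c ∈ Step.iv.cites, pending c) → O .singleLinkNecessary → O .verticalShiftSolved) :=
  (stepNode_iff pending O .iv).trans (by simp [Step.uses, Step.concl, Step.data])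
/-- NOT AUTOMATIC: all loci and all observations but `verticalShiftSolved` granted violates the node. [folklore] -/
theorem N_IUTchIII_Cor3_12_pf_iv_not_automatic :
    ¬ N_IUTchIII_Cor3_12_pf_iv (fun _ => True) (fun o => o ≠ .verticalShiftSolved) :=
  stepNode_not_automatic_of_mem .iv _ (by decide) (by decide)
/-- ∀-CLOSURE REFUTED (schema; instance forms are the content). [folklore] -/
theorem not_forall_N_IUTchIII_Cor3_12_pf_iv :
    ¬ ∀ (pending' : Locus → Prop) (O' : Obs → Prop), N_IUTchIII_Cor3_12_pf_iv pending' O' :=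
  stepNode_not_forall .iv
/-- Closure over observation readings: iff not all eight cited loci are granted. [folklore] -/
theorem forall_obs_N_IUTchIII_Cor3_12_pf_iv_iff :
    (∀ O' : Obs → Prop, N_IUTchIII_Cor3_12_pf_iv pending O') ↔ ¬ ∀ c ∈ Step.iv.cites, pending c :=
  stepNode_forall_obs_iff pending .iv
/-- Closure over loci readings: iff the content implication (iii) ⟹ (iv) holds for `O`. [folklore] -/
theorem forall_loci_N_IUTchIII_Cor3_12_pf_iv_iff :
    (∀ pending' : Locus → Prop, N_IUTchIII_Cor3_12_pf_iv pending' O) ↔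
      (O .singleLinkNecessary → O .verticalShiftSolved) :=
  (stepNode_forall_loci_iff O .iv).trans (by simp [Step.uses, Step.concl, Step.data])
/-- Zero binders at the identified-copies reading. [folklore] -/
theorem N_IUTchIII_Cor3_12_pf_iv_holds_identifiedObs : N_IUTchIII_Cor3_12_pf_iv pending P.identifiedObs :=
  stepNode_holds_identifiedObs pending P .iv (by decide)
/-- Zero binders at TEAM A's honest reading. [folklore] -/
theorem N_IUTchIII_Cor3_12_pf_iv_holds_honestReading :
    N_IUTchIII_Cor3_12_pf_iv pending (honestReading P C D L A) :=
  stepNode_holds_honestReading_preX pending P .iv (by decide) C D L A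
/-- Zero binders at the pre-(x) overlay. [folklore] -/
theorem N_IUTchIII_Cor3_12_pf_iv_holds_OPreX : N_IUTchIII_Cor3_12_pf_iv pending (Cor312Vol.PreX.OPreX P base) :=
  stepNode_holds_OPreX_preX pending P .iv (by decide) base

end Nodes

end Summit.ABC.IUTFork.DAG
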